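import Summits.QuantumFields.YangMills.Theorems.UnitScaleGibbsOneBondSchwingerDysonAdapted
import Summits.QuantumFields.YangMills.Theorems.UnitScaleGibbsSchwingerDysonGaussianDomination
import HarnessLib

/-!
# The Schwinger–Dyson identity for a DRESSED (gauge-fixed) field `V(U) = U^{g(U)}` — LINE 28 «gross-sd-transfer», construction C3
# «tree-gauge dressing», the BOOKKEEPING half of `stub_condSD` (crux `HistoryTailL`, stmt-QuantumFields-19936)

Cell `ym3-torus` (YM ladder rung R3 = continuum SU(2) Yang–Mills on T³ — a RUNG, NOT the Clay problem: not d = 4, not infinite volume, not a mass gap);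
TWIN-WIDTH helper seat `ym-ust-19936-w8` g10; `--supports stmt-QuantumFields-19936`; THEOREMS ONLY (0 `def`, 0 `sorry`, default heartbeats).  Used BY NAME:
px8 g9's ✓`UnitScaleGibbsOneBondSchwingerDysonAdapted.integral_shiftDeriv_eq_gibbsMeasure_adapted` ((SD-AD): one-bond Schwinger–Dyson along an ADAPTED
family) and px17 g7's packaging letters of ✓`UnitScaleGibbsSchwingerDysonGaussianDomination` (`hasDerivAt_exp_mul_weight_shift`, `exists_uniform_bound`, …).

WHY (ideator ym-r3-idea-2 g15∕g16, `Cruxes/HistoryTailL/GrossTransferAnnex4.md` §0 «SD STEP», skeleton v1 `stub_condSD`).  For a FIXED test field `u⁰` the observable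
`∂_{u⁰}A_W(U)` is gauge-VARIANT, so LINE 28 reads it on the GAUGE-FIXED representative `V(U) := U^{g(U)}` (`g(U)` the axial gauge of a box, a function of the
TREE-bond variables only) and flows each NON-tree bond `b` along the dressed direction `Ad(g_{b₋}(U)⁻¹)u⁰_b`: «along it `V_b ↦ e^{t·u⁰_b}V_b` and `A_W(U) = A_W(V(U))`
… `β·E[Y·e^{sY}] = s·E[e^{sY}·(∂_{u⁰}∂_{u⁰}A_W)(V)]` — Gross (2.7)–(2.9) on the gauge-fixed field, FIXED test field».  (SD-AD) is the analytic half of that sentence;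
THIS FILE IS THE BOOKKEEPING HALF for an ARBITRARY dressing `g : GaugeField P 0 G → GaugeTransf P 0 G` (sitewise measurable, ADAPTED to the flowed bonds:
`g (U[b ↦ x]) = g U`): no concrete tree, no conditional measure, no smallness enters the IDENTITY (they enter the Hessian ROWS = `stub_hessOnEvent`, and the
adaptedness∕measurability of the concrete `T4AxialGaugeSmallField.axialGauge` off its comb = px5∕px10's (AX-DOCK), neither typed here).  Abstract
`[GaugeGroup G] [MeasurableSpace G] [RegularGaugeGroup G] [HaarData G]`; the directions are FIXED multiplicative `e : ℝ → G` (e.g. `t ↦ exp(t·u⁰_b)`) and the rows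
`A′ i`, `X = Σ_i A′ i` («`∂_{u⁰}A_W`»), `X′ i` (`Σ_i X′ i` = «`∂_{u⁰}∂_{u⁰}A_W`»), `χ`, `χ′ i` are EXACTLY px17's fixed-direction rows along `W ↦ W[b i ↦ e i t·W_{b i}]`.

* §1 ★`gaugeAct_update_conj` ∕ `dressed_update_conj` — `V(U[b ↦ (g U b₋)⁻¹·c·(g U b₋)·U_b]) = (V U)[b ↦ c·(V U)_b]` (pure group algebra); private twins of the tree's
  `T4WilsonGaugeFlatDirection.plaqHol_gaugeAct` ∕ `wilsonAction_gaugeAct` (three lines each, to keep the imports at the (SD-AD) closure); `conjFamily_flow`,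
  `measurable_dressed`, `measurable_conjFamily`.
* §2 ★★`integral_shiftDeriv_dressed_eq_gibbsMeasure` — ONE BOND: `∫ φ′(V U) dμ_β = β·∫ φ(V U)·A′(V U) dμ_β` ((SD-AD) along `k U t := (g U b₋)⁻¹·e t·(g U b₋)` + §1);
  `integral_dressed_row_eq_zero` (`∫ A′(V U) dμ_β = 0`, `β > 0`).
* §3 ★★★`dressed_weighted_schwingerDyson_identity` — `β·∫ X(V U)e^{sX(V U)}χ(V U) = s·∫ (Σ_i X′ i)(V U)e^{sX(V U)}χ(V U) + ∫ e^{sX(V U)}(Σ_i χ′ i)(V U)` (all `dμ_β`,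
  every real `s`); ★★★`dressed_schwingerDyson_identity` (`χ ≡ 1`) and ★`integral_dressed_eq_zero` (`∫ X(V U) dμ_β = 0`) = EXACTLY the `hSD`∕`hX0` socket of px17's
  ✓`UnitScaleGibbsMGFTwoLevelDomination.integral_sq_le_of_sd_twoLevel` with `X ↦ X ∘ V`, `Y ↦ (Σ_i X′ i) ∘ V`, `c = β`; ★★★`dressed_energy_identity` —
  `β·∫ X(V U)² dμ_β = ∫ (Σ_i X′ i)(V U) dμ_β` = the DISPLAY of skeleton v1's `stub_condSD` for an abstract dressing and abstract rows.
HONEST SCOPE.  Exact finite-`β` identities (infrastructure); NOTHING of `stub_condSD` AS TYPED (needs (AX-DOCK) + px17's `SU(2)` slot rows), `stub_hessOnEvent`,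
`stub_peierls0`, `stub_linTest`, «ShallowFluxSecondMomentL», (Q), K1, `MeanDeviationL`, `HistoryTailL`, the rung R3, d = 4, a continuum limit or a mass gap is
proved here; LINE 28 is an idea ∕ skeleton v1, not yet a registered line; the Yang–Mills mass gap is NOT proved.

References: L. Gross, Convergence of U(1)₃ lattice gauge theory to its continuum limit, CMP 92 (1983) 137–162, Thm 2.2 and (2.7)–(2.9) [GrossCMP1983];
M. Creutz, Quarks, Gluons and Lattices (1983∕2022) Ch. 9 (gauge fixing), Ch. 11 [Creutz2022].
-/

set_option autoImplicit false

noncomputable section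

open MeasureTheory Set Filter Topology
open scoped BigOperators
open Literature.MathematicalPhysics.QuantumFieldTheory.Balaban1983to89
open Literature.MathematicalPhysics.QuantumFieldTheory.Balaban1983to89.T4GenFunBounds (gibbsMeasure isProbabilityMeasure_gibbsMeasure)
open Summit.QuantumFields.YangMills.Theorems.UnitScaleGibbsOneBondSchwingerDyson (update_mul_zero)
open Summit.QuantumFields.YangMills.Theorems.UnitScaleGibbsOneBondSchwingerDysonAdapted (integral_shiftDeriv_eq_gibbsMeasure_adapted)
open Summit.QuantumFields.YangMills.Theorems.UnitScaleGibbsSchwingerDysonGaussianDomination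
  (measurable_of_eq_sum exists_abs_le_of_eq_sum exists_uniform_bound hasDerivAt_exp_mul_weight_shift)
open Summit.QuantumFields.YangMills.Theorems.UnitScaleGibbsMGFSecondMoment (integrable_of_abs_le)

namespace Summit.QuantumFields.YangMills.Theorems.UnitScaleGibbsDressedSchwingerDyson

variable {P : Params} {G : Type} [GaugeGroup G]

/-! ## §1 Dressing algebra: gauge action vs one-bond updates, gauge invariance of the action, measurability -/

section Algebra

variable {j : ℕ}

/-- `U^u(∂p) = u(p₋)U(∂p)u(p₋)⁻¹` (private twin of the tree's `T4WilsonGaugeFlatDirection.plaqHol_gaugeAct`, re-proved to keep this file's imports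
at the (SD-AD) closure). [folklore] -/
private theorem plaqHol_gaugeAct' (u : GaugeTransf P j G) (U : GaugeField P j G) (p : Plaq P j) :
    GaugeField.plaqHol (GaugeField.gaugeAct u U) p = u p.src * GaugeField.plaqHol U p * (u p.src)⁻¹ := by
  simp only [GaugeField.plaqHol, GaugeField.gaugeAct, PBond.tgt, Site.shift_comm p.src p.ν p.μ]
  group

/-- **`A(U^u) = A(U)`** — gauge invariance of the Wilson action (private twin of the tree's `T4WilsonGaugeFlatDirection.wilsonAction_gaugeAct`,
via `GaugeGroup.reTr_conj`; re-proved to keep the imports small). [folklore] -/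
private theorem wilsonAction4_gaugeAct' (u : GaugeTransf P j G) (U : GaugeField P j G) :
    wilsonAction4 (GaugeField.gaugeAct u U) = wilsonAction4 U := by
  unfold wilsonAction4 wilsonAction
  exact Finset.sum_congr rfl fun p _ => by rw [plaqHol_gaugeAct', GaugeGroup.reTr_conj]

/-- The dressed multiplicative family `k U t := (g U x)⁻¹ · e t · (g U x)` is multiplicative in `t`. [cite: Creutz2022, Ch. 11] -/
theorem conjFamily_flow (g : GaugeField P j G → GaugeTransf P j G) (x : Site P j) {e : ℝ → G}
    (he : ∀ s t, e (s + t) = e s * e t) (U : GaugeField P j G) (s t : ℝ) :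
    (g U x)⁻¹ * e (s + t) * g U x = (g U x)⁻¹ * e s * g U x * ((g U x)⁻¹ * e t * g U x) := by
  rw [he]; simp only [mul_assoc, mul_inv_cancel_left]

/-- The dressed field `V U = U^{g U}` is a measurable function of `U` when the dressing is sitewise measurable. [folklore] -/
theorem measurable_dressed [MeasurableSpace G] [RegularGaugeGroup G] (g : GaugeField P j G → GaugeTransf P j G)
    (hgm : ∀ x, Measurable fun U => g U x) : Measurable fun U : GaugeField P j G => GaugeField.gaugeAct (g U) U := by
  refine measurable_pi_lambda _ fun b => ?_
  simp only [GaugeField.gaugeAct]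
  exact ((hgm b.src).mul (measurable_pi_apply b)).mul (hgm b.tgt).inv

/-- The dressed family `U ↦ (g U x)⁻¹ · e t · (g U x)` is measurable for each `t`. [folklore] -/
theorem measurable_conjFamily [MeasurableSpace G] [RegularGaugeGroup G] (g : GaugeField P j G → GaugeTransf P j G)
    (hgm : ∀ x, Measurable fun U => g U x) (x : Site P j) (e : ℝ → G) (t : ℝ) :
    Measurable fun U : GaugeField P j G => (g U x)⁻¹ * e t * g U x :=
  ((hgm x).inv.mul_const (e t)).mul (hgm x)

variable [DecidableEq (PBond P j)]

/-- ★ **THE DRESSING IDENTITY.**  Updating `U_b` by the `u(b₋)⁻¹`-CONJUGATE of `c` and then dressing by `u` equals dressing and then updating by `c`: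
`(U[b ↦ u(b₋)⁻¹·c·u(b₋)·U_b])^u = (U^u)[b ↦ c·(U^u)_b]` (`U^u(b) = u(b₋)U(b)u(b₊)⁻¹`).  In C3, `u = g(U)` is the axial gauge and `c = e^{t·u⁰_b}`: the flow of
`U_b` along `Ad(g_{b₋}(U)⁻¹)u⁰_b` IS the flow of `V_b` along `u⁰_b`. [cite: Creutz2022, Ch. 9] -/
theorem gaugeAct_update_conj (u : GaugeTransf P j G) (U : GaugeField P j G) (b : PBond P j) (c : G) :
    GaugeField.gaugeAct u (Function.update U b ((u b.src)⁻¹ * c * u b.src * U b)) =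
      Function.update (GaugeField.gaugeAct u U) b (c * GaugeField.gaugeAct u U b) := by
  funext b'
  by_cases hb : b' = b
  · subst hb
    simp only [GaugeField.gaugeAct, Function.update_self, mul_assoc, mul_inv_cancel_left]
  · simp only [GaugeField.gaugeAct, Function.update_of_ne hb]

/-- For an ADAPTED dressing `g` (`g (U[b ↦ x]) = g U`): `V(U[b ↦ (g U b₋)⁻¹·c·(g U b₋)·U_b]) = (V U)[b ↦ c·(V U)_b]`, `V U := U^{g U}`.
[cite: Creutz2022, Ch. 9] -/
theorem dressed_update_conj (g : GaugeField P j G → GaugeTransf P j G) (b : PBond P j)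
    (hgb : ∀ (U : GaugeField P j G) (x : G), g (Function.update U b x) = g U) (U : GaugeField P j G) (c : G) :
    GaugeField.gaugeAct (g (Function.update U b ((g U b.src)⁻¹ * c * g U b.src * U b)))
        (Function.update U b ((g U b.src)⁻¹ * c * g U b.src * U b)) =
      Function.update (GaugeField.gaugeAct (g U) U) b (c * GaugeField.gaugeAct (g U) U b) := by
  rw [hgb, gaugeAct_update_conj]

end Algebra

/-! ## §2 The one-bond Schwinger–Dyson identity read at the dressed field -/

section Dressed

variable [DecidableEq (PBond P 0)] [MeasurableSpace G] [RegularGaugeGroup G] [HaarData G]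

/-- ★★ **THE ONE-BOND SCHWINGER–DYSON IDENTITY FOR A DRESSED FIELD.**  Let `β ≥ 0`, `b` a finest bond, `g` a sitewise measurable dressing
ADAPTED to `b` (`g (U[b ↦ x]) = g U`), `V U := U^{g U}`, and `e : ℝ → G` a FIXED multiplicative family (`e (s+t) = e s · e t`).  If `φ` is bounded
measurable with a bounded measurable shift-derivative `φ′` along `W ↦ W[b ↦ e t · W_b]` at `t = 0` (at every field `W`), and `A′` is such a
derivative of `A = wilsonAction4`, then `∫ φ′(V U) dμ_β = β·∫ φ(V U)·A′(V U) dμ_β`.  Proof: (SD-AD) `integral_shiftDeriv_eq_gibbsMeasure_adapted`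
along the ADAPTED family `k U t := (g U b₋)⁻¹·e t·(g U b₋)`, whose shift of `U` is, after dressing, the `e`-shift of `V U` (§1 `dressed_update_conj`),
and `A(U[b ↦ k U t·U_b]) = A(V(U[b ↦ k U t·U_b]))` (gauge invariance). [cite: GrossCMP1983, Thm 2.2 (2.7)–(2.9); Creutz2022, Ch. 11] -/
theorem integral_shiftDeriv_dressed_eq_gibbsMeasure {β : ℝ} (hβ : 0 ≤ β) (b : PBond P 0)
    (g : GaugeField P 0 G → GaugeTransf P 0 G) (hgm : ∀ x, Measurable fun U => g U x)
    (hgb : ∀ (U : GaugeField P 0 G) (x : G), g (Function.update U b x) = g U)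
    {e : ℝ → G} (he : ∀ s t, e (s + t) = e s * e t)
    (φ φ' : GaugeField P 0 G → ℝ) (hφm : Measurable φ) (hφ'm : Measurable φ')
    {Cφ Cφ' : ℝ} (hCφ : ∀ W, |φ W| ≤ Cφ) (hCφ' : ∀ W, |φ' W| ≤ Cφ')
    (hφ' : ∀ W, HasDerivAt (fun t => φ (Function.update W b (e t * W b))) (φ' W) 0)
    (A' : GaugeField P 0 G → ℝ) (hA'm : Measurable A') {CA' : ℝ} (hCA' : ∀ W, |A' W| ≤ CA')
    (hA' : ∀ W, HasDerivAt (fun t => wilsonAction4 (Function.update W b (e t * W b))) (A' W) 0) :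
    ∫ U, φ' (GaugeField.gaugeAct (g U) U) ∂gibbsMeasure P β =
      β * ∫ U, φ (GaugeField.gaugeAct (g U) U) * A' (GaugeField.gaugeAct (g U) U) ∂gibbsMeasure P β := by
  set V : GaugeField P 0 G → GaugeField P 0 G := fun U => GaugeField.gaugeAct (g U) U with hV
  have hVm : Measurable V := measurable_dressed g hgm
  -- the dressed (adapted) family
  set k : GaugeField P 0 G → ℝ → G := fun U t => (g U b.src)⁻¹ * e t * g U b.src with hk
  have hkflow : ∀ (U : GaugeField P 0 G) (s t : ℝ), k U (s + t) = k U s * k U t := fun U s t => conjFamily_flow g b.src he U s t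
  have hkb : ∀ (U : GaugeField P 0 G) (x : G), k (Function.update U b x) = k U := fun U x => by simp only [hk, hgb]
  have hkm : ∀ t, Measurable fun U => k U t := fun t => measurable_conjFamily g hgm b.src e t
  -- the dressing identity along the family; rows of `φ ∘ V` and of `A` along it
  have hVk : ∀ (U : GaugeField P 0 G) (t : ℝ),
      V (Function.update U b (k U t * U b)) = Function.update (V U) b (e t * V U b) := fun U t => by
    simp only [hV, hk]; exact dressed_update_conj g b hgb U (e t)
  have hf' : ∀ U, HasDerivAt (fun t => φ (V (Function.update U b (k U t * U b)))) (φ' (V U)) 0 := fun U => by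
    simp only [hVk]; exact hφ' (V U)
  have hA'' : ∀ U, HasDerivAt (fun t => wilsonAction4 (Function.update U b (k U t * U b))) (A' (V U)) 0 := fun U => by
    have h : ∀ t, wilsonAction4 (Function.update U b (k U t * U b)) =
        wilsonAction4 (Function.update (V U) b (e t * V U b)) := fun t => by
      rw [← hVk, hV]; exact (wilsonAction4_gaugeAct' _ _).symm
    simp only [h]; exact hA' (V U)
  exact integral_shiftDeriv_eq_gibbsMeasure_adapted hβ b hkflow hkb hkm (fun U => φ (V U)) (fun U => φ' (V U))
    (hφm.comp hVm) (hφ'm.comp hVm) (fun U => hCφ (V U)) (fun U => hCφ' (V U)) hf'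
    (fun U => A' (V U)) (hA'm.comp hVm) (fun U => hCA' (V U)) hA''

/-- **A DRESSED ACTION ROW IS CENTRED**: `∫ A′(V U) dμ_β = 0` for `β > 0` (§2 at `φ ≡ 1`, `φ′ ≡ 0`). [cite: GrossCMP1983, Thm 2.2] -/
theorem integral_dressed_row_eq_zero {β : ℝ} (hβ : 0 < β) (b : PBond P 0)
    (g : GaugeField P 0 G → GaugeTransf P 0 G) (hgm : ∀ x, Measurable fun U => g U x)
    (hgb : ∀ (U : GaugeField P 0 G) (x : G), g (Function.update U b x) = g U)
    {e : ℝ → G} (he : ∀ s t, e (s + t) = e s * e t)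
    (A' : GaugeField P 0 G → ℝ) (hA'm : Measurable A') {CA' : ℝ} (hCA' : ∀ W, |A' W| ≤ CA')
    (hA' : ∀ W, HasDerivAt (fun t => wilsonAction4 (Function.update W b (e t * W b))) (A' W) 0) :
    ∫ U, A' (GaugeField.gaugeAct (g U) U) ∂gibbsMeasure P β = 0 := by
  have h := integral_shiftDeriv_dressed_eq_gibbsMeasure hβ.le b g hgm hgb he (fun _ => (1 : ℝ)) (fun _ => (0 : ℝ))
    measurable_const measurable_const (Cφ := 1) (Cφ' := 0) (fun _ => by simp) (fun _ => by simp)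
    (fun W => by simpa using hasDerivAt_const (0 : ℝ) (1 : ℝ)) A' hA'm hCA' hA'
  simp only [integral_const, smul_eq_mul, mul_zero, one_mul] at h
  exact (mul_eq_zero.1 h.symm).resolve_left hβ.ne'

/-! ## §3 The summed Schwinger–Dyson identity read at the dressed field -/

variable {ι : Type} [Fintype ι]

/-- ★★★ **THE SUMMED SCHWINGER–DYSON IDENTITY FOR A DRESSED FIELD, WITH A SHIFT-DIFFERENTIABLE WEIGHT** (`β ≥ 0`, every real `s`).
Data: a sitewise measurable dressing `g` ADAPTED to every bond `b i` (`g (U[b i ↦ x]) = g U`), `V U := U^{g U}`; FIXED multiplicative directions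
`e i`; px17's fixed-direction rows `A′ i` (of the action), `X = Σ_i A′ i` («`∂_{u⁰}A_W`»), `X′ i` (of `X`; `Σ_i X′ i` = «`∂_{u⁰}∂_{u⁰}A_W`»), and a weight
`χ` with rows `χ′ i` — all along `W ↦ W[b i ↦ e i t · W_{b i}]` at every field `W`.  Then
`β·∫ X(V U)·e^{s·X(V U)}·χ(V U) dμ_β = s·∫ (Σ_i X′ i)(V U)·e^{s·X(V U)}·χ(V U) dμ_β + ∫ e^{s·X(V U)}·(Σ_i χ′ i)(V U) dμ_β`.
Proof: §2 at `φ = e^{sX}χ` for each `i` (rows by px17's `hasDerivAt_exp_mul_weight_shift`), summed over `i` with `Σ_i A′ i = X` — px17's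
`weighted_schwingerDyson_identity` verbatim with every integrand read at `V U`. [cite: GrossCMP1983, Thm 2.2 (proof)] -/
theorem dressed_weighted_schwingerDyson_identity {β : ℝ} (hβ : 0 ≤ β)
    (g : GaugeField P 0 G → GaugeTransf P 0 G) (hgm : ∀ x, Measurable fun U => g U x)
    (b : ι → PBond P 0) (hgb : ∀ (i : ι) (U : GaugeField P 0 G) (x : G), g (Function.update U (b i) x) = g U)
    (e : ι → ℝ → G) (he : ∀ i s t, e i (s + t) = e i s * e i t)
    (A' : ι → GaugeField P 0 G → ℝ) (hA'm : ∀ i, Measurable (A' i)) (hA'b : ∀ i, ∃ C, ∀ W, |A' i W| ≤ C)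
    (hA' : ∀ i W, HasDerivAt (fun t => wilsonAction4 (Function.update W (b i) (e i t * W (b i)))) (A' i W) 0)
    (X : GaugeField P 0 G → ℝ) (hX : ∀ W, X W = ∑ i, A' i W)
    (X' : ι → GaugeField P 0 G → ℝ) (hX'm : ∀ i, Measurable (X' i)) (hX'b : ∀ i, ∃ C, ∀ W, |X' i W| ≤ C)
    (hX' : ∀ i W, HasDerivAt (fun t => X (Function.update W (b i) (e i t * W (b i)))) (X' i W) 0)
    (χ : GaugeField P 0 G → ℝ) (hχm : Measurable χ) {M : ℝ} (hχM : ∀ W, |χ W| ≤ M)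
    (χ' : ι → GaugeField P 0 G → ℝ) (hχ'm : ∀ i, Measurable (χ' i)) (hχ'b : ∀ i, ∃ C, ∀ W, |χ' i W| ≤ C)
    (hχ' : ∀ i W, HasDerivAt (fun t => χ (Function.update W (b i) (e i t * W (b i)))) (χ' i W) 0) (s : ℝ) :
    β * ∫ U, X (GaugeField.gaugeAct (g U) U) * Real.exp (s * X (GaugeField.gaugeAct (g U) U)) *
        χ (GaugeField.gaugeAct (g U) U) ∂gibbsMeasure P β =
      s * ∫ U, (∑ i, X' i (GaugeField.gaugeAct (g U) U)) * Real.exp (s * X (GaugeField.gaugeAct (g U) U)) *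
          χ (GaugeField.gaugeAct (g U) U) ∂gibbsMeasure P β +
        ∫ U, Real.exp (s * X (GaugeField.gaugeAct (g U) U)) * (∑ i, χ' i (GaugeField.gaugeAct (g U) U))
          ∂gibbsMeasure P β := by
  haveI := isProbabilityMeasure_gibbsMeasure (G := G) P hβ
  set μ := gibbsMeasure (G := G) P β with hμ
  set V : GaugeField P 0 G → GaugeField P 0 G := fun U => GaugeField.gaugeAct (g U) U with hV
  have hVm : Measurable V := measurable_dressed g hgm
  have hXm : Measurable X := measurable_of_eq_sum A' hA'm X hX
  obtain ⟨B, hB0, hXB⟩ := exists_abs_le_of_eq_sum A' hA'b X hX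
  obtain ⟨CX, hCX0, hCX⟩ := exists_uniform_bound X' hX'b
  obtain ⟨Cχ, hCχ0, hCχ⟩ := exists_uniform_bound χ' hχ'b
  obtain ⟨CA, hCA0, hCA⟩ := exists_uniform_bound A' hA'b
  have hM0 : 0 ≤ M := (abs_nonneg _).trans (hχM 1)
  -- the observable `f = e^{sX} χ` and its fixed-direction shift-derivatives
  set f : GaugeField P 0 G → ℝ := fun W => Real.exp (s * X W) * χ W with hf
  set f' : ι → GaugeField P 0 G → ℝ := fun i W => s * X' i W * Real.exp (s * X W) * χ W + Real.exp (s * X W) * χ' i W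
    with hf'
  have hexp_le : ∀ W, Real.exp (s * X W) ≤ Real.exp (|s| * B) := fun W => by
    refine Real.exp_le_exp.2 ?_
    calc s * X W ≤ |s * X W| := le_abs_self _
      _ = |s| * |X W| := abs_mul _ _
      _ ≤ |s| * B := mul_le_mul_of_nonneg_left (hXB W) (abs_nonneg _)
  have hfm : Measurable f := ((measurable_const.mul hXm).exp).mul hχm
  have hCf : ∀ W, |f W| ≤ Real.exp (|s| * B) * M := fun W => by
    rw [hf]; dsimp only
    rw [abs_mul, abs_of_pos (Real.exp_pos _)]
    exact mul_le_mul (hexp_le W) (hχM W) (abs_nonneg _) (Real.exp_pos _).le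
  have hf'm : ∀ i, Measurable (f' i) := fun i =>
    ((((measurable_const.mul (hX'm i)).mul (measurable_const.mul hXm).exp).mul hχm)).add
      (((measurable_const.mul hXm).exp).mul (hχ'm i))
  have hCf' : ∀ i W, |f' i W| ≤ |s| * CX * Real.exp (|s| * B) * M + Real.exp (|s| * B) * Cχ := fun i W => by
    rw [hf']; dsimp only
    have h1 : |s * X' i W * Real.exp (s * X W) * χ W| ≤ |s| * CX * Real.exp (|s| * B) * M := by
      rw [abs_mul, abs_mul, abs_mul, abs_of_pos (Real.exp_pos _)]
      have := hCX i W; have := hχM W; have := hexp_le W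
      gcongr
    have h2 : |Real.exp (s * X W) * χ' i W| ≤ Real.exp (|s| * B) * Cχ := by
      rw [abs_mul, abs_of_pos (Real.exp_pos _)]
      exact mul_le_mul (hexp_le W) (hCχ i W) (abs_nonneg _) (Real.exp_pos _).le
    exact (abs_add_le _ _).trans (add_le_add h1 h2)
  have hf'd : ∀ i W, HasDerivAt (fun t => f (Function.update W (b i) (e i t * W (b i)))) (f' i W) 0 :=
    fun i W => hasDerivAt_exp_mul_weight_shift b e he X X' hX' χ χ' hχ' s i W
  -- one-bond dressed Schwinger–Dyson for each `i`
  have hSD : ∀ i, ∫ U, f' i (V U) ∂μ = β * ∫ U, f (V U) * A' i (V U) ∂μ := fun i =>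
    integral_shiftDeriv_dressed_eq_gibbsMeasure hβ (b i) g hgm (hgb i) (he i) f (f' i) hfm (hf'm i) hCf (hCf' i)
      (hf'd i) (A' i) (hA'm i) (hCA i) (hA' i)
  -- integrability bookkeeping (every integrand read at `V U`)
  have hi1 : ∀ i, Integrable (fun U => s * X' i (V U) * Real.exp (s * X (V U)) * χ (V U)) μ := fun i => by
    refine integrable_of_abs_le μ
      ((((measurable_const.mul ((hX'm i).comp hVm)).mul (measurable_const.mul (hXm.comp hVm)).exp).mul (hχm.comp hVm)))
      (C := |s| * CX * Real.exp (|s| * B) * M) fun U => ?_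
    rw [abs_mul, abs_mul, abs_mul, abs_of_pos (Real.exp_pos _)]
    have := hCX i (V U); have := hχM (V U); have := hexp_le (V U)
    gcongr
  have hi2 : ∀ i, Integrable (fun U => Real.exp (s * X (V U)) * χ' i (V U)) μ := fun i => by
    refine integrable_of_abs_le μ (((measurable_const.mul (hXm.comp hVm)).exp).mul ((hχ'm i).comp hVm))
      (C := Real.exp (|s| * B) * Cχ) fun U => ?_
    rw [abs_mul, abs_of_pos (Real.exp_pos _)]
    exact mul_le_mul (hexp_le (V U)) (hCχ i (V U)) (abs_nonneg _) (Real.exp_pos _).le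
  have hifA : ∀ i, Integrable (fun U => f (V U) * A' i (V U)) μ := fun i => by
    refine integrable_of_abs_le μ ((hfm.comp hVm).mul ((hA'm i).comp hVm)) (C := Real.exp (|s| * B) * M * CA) fun U => ?_
    rw [abs_mul]
    exact mul_le_mul (hCf (V U)) (hCA i (V U)) (abs_nonneg _) (by positivity)
  -- sum the identities over `i`
  have hsum : ∑ i, ∫ U, f' i (V U) ∂μ = β * ∑ i, ∫ U, f (V U) * A' i (V U) ∂μ := by
    rw [Finset.mul_sum]
    exact Finset.sum_congr rfl fun i _ => hSD i
  -- left side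
  have hL : ∑ i, ∫ U, f' i (V U) ∂μ =
      s * ∫ U, (∑ i, X' i (V U)) * Real.exp (s * X (V U)) * χ (V U) ∂μ +
        ∫ U, Real.exp (s * X (V U)) * (∑ i, χ' i (V U)) ∂μ := by
    have h1 : ∑ i, ∫ U, f' i (V U) ∂μ =
        ∑ i, (∫ U, s * X' i (V U) * Real.exp (s * X (V U)) * χ (V U) ∂μ +
          ∫ U, Real.exp (s * X (V U)) * χ' i (V U) ∂μ) := by
      refine Finset.sum_congr rfl fun i _ => ?_
      rw [← integral_add (hi1 i) (hi2 i)]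
    rw [h1, Finset.sum_add_distrib, ← integral_finsetSum _ (fun i _ => hi1 i), ← integral_finsetSum _ (fun i _ => hi2 i),
      ← integral_const_mul]
    congr 1
    · refine integral_congr_ae (ae_of_all _ fun U => ?_)
      dsimp only
      rw [Finset.sum_mul, Finset.sum_mul, Finset.mul_sum]
      refine Finset.sum_congr rfl fun i _ => ?_
      ring
    · refine integral_congr_ae (ae_of_all _ fun U => ?_)
      dsimp only
      rw [Finset.mul_sum]
  -- right side
  have hR : ∑ i, ∫ U, f (V U) * A' i (V U) ∂μ = ∫ U, X (V U) * Real.exp (s * X (V U)) * χ (V U) ∂μ := by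
    rw [← integral_finsetSum _ (fun i _ => hifA i)]
    refine integral_congr_ae (ae_of_all _ fun U => ?_)
    show ∑ i, f (V U) * A' i (V U) = X (V U) * Real.exp (s * X (V U)) * χ (V U)
    rw [← Finset.mul_sum, ← hX (V U), hf]
    ring
  show β * ∫ U, X (V U) * Real.exp (s * X (V U)) * χ (V U) ∂μ =
    s * ∫ U, (∑ i, X' i (V U)) * Real.exp (s * X (V U)) * χ (V U) ∂μ +
      ∫ U, Real.exp (s * X (V U)) * (∑ i, χ' i (V U)) ∂μ
  rw [← hR, ← hsum, hL]

/-- ★★★ **THE SUMMED SCHWINGER–DYSON IDENTITY FOR A DRESSED FIELD** (no weight; `β ≥ 0`, every real `s`):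
`β·∫ X(V U)·e^{s·X(V U)} dμ_β = s·∫ (Σ_i X′ i)(V U)·e^{s·X(V U)} dμ_β` — Gross's `β φ′(s) = s·E[e^{sY}·∂_{u⁰}∂_{u⁰}A_W]` read at the gauge-fixed
field with a FIXED test field (annex 4 §0 «SD STEP»); the shape of the hypothesis `hSD` of px17's `UnitScaleGibbsMGFTwoLevelDomination.integral_sq_le_of_sd_twoLevel`
with `X ↦ X ∘ V`, `Y ↦ (Σ_i X′ i) ∘ V`, `c = β`. [cite: GrossCMP1983, Thm 2.2 (2.7)–(2.9)] -/
theorem dressed_schwingerDyson_identity {β : ℝ} (hβ : 0 ≤ β)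
    (g : GaugeField P 0 G → GaugeTransf P 0 G) (hgm : ∀ x, Measurable fun U => g U x)
    (b : ι → PBond P 0) (hgb : ∀ (i : ι) (U : GaugeField P 0 G) (x : G), g (Function.update U (b i) x) = g U)
    (e : ι → ℝ → G) (he : ∀ i s t, e i (s + t) = e i s * e i t)
    (A' : ι → GaugeField P 0 G → ℝ) (hA'm : ∀ i, Measurable (A' i)) (hA'b : ∀ i, ∃ C, ∀ W, |A' i W| ≤ C)
    (hA' : ∀ i W, HasDerivAt (fun t => wilsonAction4 (Function.update W (b i) (e i t * W (b i)))) (A' i W) 0)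
    (X : GaugeField P 0 G → ℝ) (hX : ∀ W, X W = ∑ i, A' i W)
    (X' : ι → GaugeField P 0 G → ℝ) (hX'm : ∀ i, Measurable (X' i)) (hX'b : ∀ i, ∃ C, ∀ W, |X' i W| ≤ C)
    (hX' : ∀ i W, HasDerivAt (fun t => X (Function.update W (b i) (e i t * W (b i)))) (X' i W) 0) (s : ℝ) :
    β * ∫ U, X (GaugeField.gaugeAct (g U) U) * Real.exp (s * X (GaugeField.gaugeAct (g U) U)) ∂gibbsMeasure P β =
      s * ∫ U, (∑ i, X' i (GaugeField.gaugeAct (g U) U)) * Real.exp (s * X (GaugeField.gaugeAct (g U) U))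
        ∂gibbsMeasure P β := by
  have h := dressed_weighted_schwingerDyson_identity hβ g hgm b hgb e he A' hA'm hA'b hA' X hX X' hX'm hX'b hX'
    (fun _ => (1 : ℝ)) measurable_const (M := 1) (fun _ => by simp) (fun _ _ => (0 : ℝ)) (fun _ => measurable_const)
    (fun _ => ⟨0, fun _ => by simp⟩) (fun i W => by
      simpa using (hasDerivAt_const (0 : ℝ) (1 : ℝ))) s
  simpa using h

/-- ★★★ **THE DRESSED ENERGY IDENTITY** (`β ≥ 0`): `β·∫ X(V U)² dμ_β = ∫ (Σ_i X′ i)(V U) dμ_β` — §2 at `φ = X` for each `i`, summed with `Σ_i A′ i = X`;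
Gross's (2.9) at `s`-order one, read at the dressed field: «`β_K·∫ (∂_u A_W)(V U)² = ∫ (∂_u∂_u A_W)(V U)`» — the DISPLAY of LINE 28 skeleton v1's `stub_condSD`
(ideator ym-r3-idea-2 g16) for an abstract dressing and abstract rows. [cite: GrossCMP1983, Thm 2.2 (2.9)] -/
theorem dressed_energy_identity {β : ℝ} (hβ : 0 ≤ β)
    (g : GaugeField P 0 G → GaugeTransf P 0 G) (hgm : ∀ x, Measurable fun U => g U x)
    (b : ι → PBond P 0) (hgb : ∀ (i : ι) (U : GaugeField P 0 G) (x : G), g (Function.update U (b i) x) = g U)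
    (e : ι → ℝ → G) (he : ∀ i s t, e i (s + t) = e i s * e i t)
    (A' : ι → GaugeField P 0 G → ℝ) (hA'm : ∀ i, Measurable (A' i)) (hA'b : ∀ i, ∃ C, ∀ W, |A' i W| ≤ C)
    (hA' : ∀ i W, HasDerivAt (fun t => wilsonAction4 (Function.update W (b i) (e i t * W (b i)))) (A' i W) 0)
    (X : GaugeField P 0 G → ℝ) (hX : ∀ W, X W = ∑ i, A' i W)
    (X' : ι → GaugeField P 0 G → ℝ) (hX'm : ∀ i, Measurable (X' i)) (hX'b : ∀ i, ∃ C, ∀ W, |X' i W| ≤ C)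
    (hX' : ∀ i W, HasDerivAt (fun t => X (Function.update W (b i) (e i t * W (b i)))) (X' i W) 0) :
    β * ∫ U, X (GaugeField.gaugeAct (g U) U) ^ 2 ∂gibbsMeasure P β =
      ∫ U, (∑ i, X' i (GaugeField.gaugeAct (g U) U)) ∂gibbsMeasure P β := by
  haveI := isProbabilityMeasure_gibbsMeasure (G := G) P hβ
  set μ := gibbsMeasure (G := G) P β with hμ
  set V : GaugeField P 0 G → GaugeField P 0 G := fun U => GaugeField.gaugeAct (g U) U with hV
  have hVm : Measurable V := measurable_dressed g hgm
  have hXm : Measurable X := measurable_of_eq_sum A' hA'm X hX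
  obtain ⟨B, hB0, hXB⟩ := exists_abs_le_of_eq_sum A' hA'b X hX
  obtain ⟨CX, hCX0, hCX⟩ := exists_uniform_bound X' hX'b
  obtain ⟨CA, hCA0, hCA⟩ := exists_uniform_bound A' hA'b
  -- one-bond dressed Schwinger–Dyson at `φ = X` for each `i`
  have hSD : ∀ i, ∫ U, X' i (V U) ∂μ = β * ∫ U, X (V U) * A' i (V U) ∂μ := fun i =>
    integral_shiftDeriv_dressed_eq_gibbsMeasure hβ (b i) g hgm (hgb i) (he i) X (X' i) hXm (hX'm i) hXB (hCX i)
      (hX' i) (A' i) (hA'm i) (hCA i) (hA' i)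
  have hiX' : ∀ i, Integrable (fun U => X' i (V U)) μ := fun i =>
    integrable_of_abs_le μ ((hX'm i).comp hVm) (C := CX) fun U => hCX i (V U)
  have hiXA : ∀ i, Integrable (fun U => X (V U) * A' i (V U)) μ := fun i => by
    refine integrable_of_abs_le μ ((hXm.comp hVm).mul ((hA'm i).comp hVm)) (C := B * CA) fun U => ?_
    rw [abs_mul]
    exact mul_le_mul (hXB (V U)) (hCA i (V U)) (abs_nonneg _) hB0
  have h1 : (fun U => X (V U) ^ 2) = fun U => ∑ i, X (V U) * A' i (V U) := funext fun U => by
    rw [sq, ← Finset.mul_sum, ← hX (V U)]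
  show β * ∫ U, X (V U) ^ 2 ∂μ = ∫ U, (∑ i, X' i (V U)) ∂μ
  rw [h1, integral_finsetSum _ (fun i _ => hiXA i), integral_finsetSum _ (fun i _ => hiX' i), Finset.mul_sum]
  exact Finset.sum_congr rfl fun i _ => (hSD i).symm

/-- ★ **THE DRESSED OBSERVABLE IS CENTRED**: `∫ X(V U) dμ_β = 0` for `β > 0` (`X = Σ_i A′ i`, each dressed row centred by §2) — the hypothesis
`hX0` of px17's `UnitScaleGibbsMGFTwoLevelDomination`. [cite: GrossCMP1983, Thm 2.2] -/
theorem integral_dressed_eq_zero {β : ℝ} (hβ : 0 < β)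
    (g : GaugeField P 0 G → GaugeTransf P 0 G) (hgm : ∀ x, Measurable fun U => g U x)
    (b : ι → PBond P 0) (hgb : ∀ (i : ι) (U : GaugeField P 0 G) (x : G), g (Function.update U (b i) x) = g U)
    (e : ι → ℝ → G) (he : ∀ i s t, e i (s + t) = e i s * e i t)
    (A' : ι → GaugeField P 0 G → ℝ) (hA'm : ∀ i, Measurable (A' i)) (hA'b : ∀ i, ∃ C, ∀ W, |A' i W| ≤ C)
    (hA' : ∀ i W, HasDerivAt (fun t => wilsonAction4 (Function.update W (b i) (e i t * W (b i)))) (A' i W) 0)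
    (X : GaugeField P 0 G → ℝ) (hX : ∀ W, X W = ∑ i, A' i W) :
    ∫ U, X (GaugeField.gaugeAct (g U) U) ∂gibbsMeasure P β = 0 := by
  haveI := isProbabilityMeasure_gibbsMeasure (G := G) P hβ.le
  set μ := gibbsMeasure (G := G) P β with hμ
  set V : GaugeField P 0 G → GaugeField P 0 G := fun U => GaugeField.gaugeAct (g U) U with hV
  have hVm : Measurable V := measurable_dressed g hgm
  obtain ⟨CA, hCA0, hCA⟩ := exists_uniform_bound A' hA'b
  have h0 : ∀ i, ∫ U, A' i (V U) ∂μ = 0 := fun i =>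
    integral_dressed_row_eq_zero hβ (b i) g hgm (hgb i) (he i) (A' i) (hA'm i) (hCA i) (hA' i)
  have hiA : ∀ i, Integrable (fun U => A' i (V U)) μ := fun i =>
    integrable_of_abs_le μ ((hA'm i).comp hVm) (C := CA) fun U => hCA i (V U)
  have h1 : (fun U => X (V U)) = fun U => ∑ i, A' i (V U) := funext fun U => hX (V U)
  show ∫ U, X (V U) ∂μ = 0
  rw [h1, integral_finsetSum _ (fun i _ => hiA i)]
  exact Finset.sum_eq_zero fun i _ => h0 i

end Dressed

end Summit.QuantumFields.YangMills.Theorems.UnitScaleGibbsDressedSchwingerDyson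

end
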